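import Summits.CriticalPhenomena.PercolationContinuityZ3.Theorems.PercNearOneGluingNoHeavyLowerTailKnQuestion8CoefficientwiseCoreClassKernelMixBundleCleanThread
import Summits.CriticalPhenomena.PercolationContinuityZ3.Theorems.PercNearOneGluingNoHeavyLowerTailKnQuestion8CoefficientwiseCoreClassKernelMixBundleFill
import Summits.CriticalPhenomena.PercolationContinuityZ3.Theorems.PercNearOneGluingNoHeavyLowerTailKnQuestion8CoefficientwiseCoreClassKernelMixBundleTwoFreeze
import HarnessLib

/-!
# Boundary inequality on bundles, XX: CONJECTURE IET on EVERY three-thread bundle (the 0/1 count)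

Support file (`--supports stmt-CriticalPhenomena-4575`, closed), prover `prim-cplus-coupling` (gen 59).  No definitions, no notations, no named facts,
no sorries; standard axioms.  Memo `prim-cplus-coupling/A5-COUPLING-gen59.md` §2 (THEOREM IET(3)).

`Coefficientwise.bundle_three_thread_count`: on an explicit bundle whose threads are exactly `t₀, t₁, t₂`, for EVERY up-closed event `𝒱` and all monotone
`{0,1}`-valued levels `hᵃ, hᵇ ≤ h`, `kᵃ, kᵇ ≤ k`:  `#bad₁(𝒱) + #bad₂(𝒱) ≤ #{λ ∈ 𝒱 supply : h(X) = k(X) = 1} + #P₁(𝒱)`.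
PROOF (memo §2).  If a type has no source: the merged scheme with no frozen thread (Harris) pays the other type by `L`-points.  If for some thread `z` both
types have a source not starting red on `z`: THEOREM CT-COUNT (`bundle_clean_thread_count`) pays the sources not blue-starting on `z` by supply points starting
red on `z` and `P₁` points with `z` blue, and the FILL LEMMA (`bundle_fill_count`) pays the sources blue-starting on `z` by supply points blue-starting on `z`.
Otherwise every thread has all sources of one of the types starting red on it, a type with a source occupies at most two threads this way, and the TWO-FREEZE
THEOREM (`bundle_two_freeze_count`) pays everything by `(L₁ ∪ L₂)`-points.  The real-level IET statement is `…BundleThreeThreadIET`.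
[cite: KozmaNitzan2024, Questions 8–9 (§5.5 p. 36) (context); Harris 1960]
-/

namespace Summit.CriticalPhenomena.PercolationContinuityZ3.Theorems

open Finset Literature.Probability.Percolation

namespace Coefficientwise

variable {ι V : Type*}

open Classical in
/-- **THEOREM IET(3), count form (three threads, all 0/1 levels, every up-set).**  Module docstring.  Memo gen 59 §2.
[cite: KozmaNitzan2024, Questions 8–9 (§5.5 p. 36) (context); Harris 1960] -/
theorem bundle_three_thread_count (ends : ι → Sym2 V) (r : ℕ) (L : ℕ → ℕ) (hL : ∀ t, t < r → 1 ≤ L t)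
    (w : ℕ → ℕ → V) (e : ℕ → ℕ → ι) (u b : V)
    (hw0 : ∀ t, t < r → w t 0 = u) (hwL : ∀ t, t < r → w t (L t) = b)
    (harc : ∀ t, t < r → ∀ j, 1 ≤ j → j ≤ L t → ends (e t j) = s(w t (j - 1), w t j))
    (hwinj : ∀ t, t < r → ∀ i j, i ≤ L t → j ≤ L t → w t i = w t j → i = j)
    (hcross : ∀ t t', t < r → t' < r → t ≠ t' → ∀ i j, i ≤ L t → j ≤ L t' → w t i = w t' j → (i = 0 ∧ j = 0) ∨ (i = L t ∧ j = L t'))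
    (A : ℕ → Finset ι) (hA : ∀ t, t < r → ∀ i, i ∈ A t ↔ ∃ j, 1 ≤ j ∧ j ≤ L t ∧ e t j = i)
    (hAdisj : ∀ t t', t < r → t' < r → t ≠ t' → Disjoint (A t) (A t'))
    (E : Finset ι) (hEA : ∀ i, i ∈ E ↔ ∃ t, t < r ∧ i ∈ A t)
    (t₀ t₁ t₂ : ℕ) (ht₀ : t₀ < r) (ht₁ : t₁ < r) (ht₂ : t₂ < r) (h01 : t₀ ≠ t₁) (h02 : t₀ ≠ t₂) (h12 : t₁ ≠ t₂)
    (hr3 : ∀ t, t < r → t = t₀ ∨ t = t₁ ∨ t = t₂)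
    (𝒱 : Finset ι → Prop) (hV : ∀ ⦃s t : Finset ι⦄, s ⊆ t → 𝒱 s → 𝒱 t)
    (h k ha hb ka kb : Set V → ℝ) (mha : Monotone ha) (mhb : Monotone hb) (mka : Monotone ka) (mkb : Monotone kb)
    (h01' : ∀ S, h S = 0 ∨ h S = 1) (k01 : ∀ S, k S = 0 ∨ k S = 1)
    (ha01 : ∀ S, ha S = 0 ∨ ha S = 1) (hb01 : ∀ S, hb S = 0 ∨ hb S = 1) (ka01 : ∀ S, ka S = 0 ∨ ka S = 1) (kb01 : ∀ S, kb S = 0 ∨ kb S = 1)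
    (hah : ∀ S, ha S ≤ h S) (hbh : ∀ S, hb S ≤ h S) (kak : ∀ S, ka S ≤ k S) (kbk : ∀ S, kb S ≤ k S) :
    ((E.powerset).filter (fun σ => 𝒱 σ ∧
        (b ∈ openCluster (ends '' (↑(E \ σ) : Set ι)) u ∧ b ∉ openCluster (ends '' (↑σ : Set ι)) u) ∧
        (ha (openCluster (ends '' (↑σ : Set ι)) u) = 1 ∧ hb (openCluster (ends '' (↑(E \ σ) : Set ι)) u) = 0) ∧
        (kb (openCluster (ends '' (↑(E \ σ) : Set ι)) u) = 1 ∧ ka (openCluster (ends '' (↑σ : Set ι)) u) = 0))).card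
    + ((E.powerset).filter (fun σ => 𝒱 σ ∧
        (b ∈ openCluster (ends '' (↑(E \ σ) : Set ι)) u ∧ b ∉ openCluster (ends '' (↑σ : Set ι)) u) ∧
        (ka (openCluster (ends '' (↑σ : Set ι)) u) = 1 ∧ kb (openCluster (ends '' (↑(E \ σ) : Set ι)) u) = 0) ∧
        (hb (openCluster (ends '' (↑(E \ σ) : Set ι)) u) = 1 ∧ ha (openCluster (ends '' (↑σ : Set ι)) u) = 0))).card
    ≤ ((E.powerset).filter (fun lam => 𝒱 lam ∧
        (b ∈ openCluster (ends '' (↑lam : Set ι)) u ∧ b ∉ openCluster (ends '' (↑(E \ lam) : Set ι)) u) ∧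
        h (openCluster (ends '' (↑lam : Set ι)) u) = 1 ∧ k (openCluster (ends '' (↑lam : Set ι)) u) = 1)).card
      + ((E.powerset).filter (fun σ => 𝒱 σ ∧
        (b ∈ openCluster (ends '' (↑(E \ σ) : Set ι)) u ∧ b ∉ openCluster (ends '' (↑σ : Set ι)) u) ∧
        (ha (openCluster (ends '' (↑σ : Set ι)) u) = 1 ∧ ka (openCluster (ends '' (↑σ : Set ι)) u) = 1 ∧
          hb (openCluster (ends '' (↑(E \ σ) : Set ι)) u) = 0 ∧ kb (openCluster (ends '' (↑(E \ σ) : Set ι)) u) = 0))).card := by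
  set C : Finset ι → Set V := fun ω => openCluster (ends '' (↑ω : Set ι)) u with hC
  have hr : 0 < r := lt_of_le_of_lt (Nat.zero_le t₀) ht₀
  have hAE : ∀ t, t < r → A t ⊆ E := fun t ht i hi => (hEA i).mpr ⟨t, ht, hi⟩
  have heA : ∀ t, t < r → ∀ j, 1 ≤ j → j ≤ L t → e t j ∈ A t := fun t ht j hj1 hjL => (hA t ht _).mpr ⟨j, hj1, hjL, rfl⟩
  have full_iff : ∀ ω : Finset ι, ω ⊆ E → (b ∈ C ω ↔ ∃ t, t < r ∧ A t ⊆ ω) := fun ω hω =>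
    bundle_b_mem_cluster_iff_threads ends r L hL w e u b hr hw0 hwL harc hwinj hcross A hA E hEA ω hω
  have up1 : ∀ (f g : Set V → ℝ), (∀ S, g S = 0 ∨ g S = 1) → (∀ S, f S ≤ g S) → ∀ S, f S = 1 → g S = 1 := by
    intro f g g01 hfg S e1
    rcases g01 S with h0 | h0
    · have := hfg S; rw [e1, h0] at this; linarith
    · exact h0
  have hIcc : ∀ t, t < r → ({0} : Finset ℕ) ≠ Finset.Icc 1 (L t - 1) := by
    intro t _ h
    have : (0 : ℕ) ∈ Finset.Icc 1 (L t - 1) := by rw [← h]; exact Finset.mem_singleton_self 0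
    rw [Finset.mem_Icc] at this; omega
  -- ## atoms
  set B₁ : Finset (Finset ι) := (E.powerset).filter (fun σ => 𝒱 σ ∧ (b ∈ C (E \ σ) ∧ b ∉ C σ) ∧ (ha (C σ) = 1 ∧ hb (C (E \ σ)) = 0) ∧
      (kb (C (E \ σ)) = 1 ∧ ka (C σ) = 0)) with hB₁
  set B₂ : Finset (Finset ι) := (E.powerset).filter (fun σ => 𝒱 σ ∧ (b ∈ C (E \ σ) ∧ b ∉ C σ) ∧ (ka (C σ) = 1 ∧ kb (C (E \ σ)) = 0) ∧
      (hb (C (E \ σ)) = 1 ∧ ha (C σ) = 0)) with hB₂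
  set T : Finset (Finset ι) := (E.powerset).filter (fun lam => 𝒱 lam ∧ (b ∈ C lam ∧ b ∉ C (E \ lam)) ∧ h (C lam) = 1 ∧ k (C lam) = 1) with hT
  set P : Finset (Finset ι) := (E.powerset).filter (fun σ => 𝒱 σ ∧ (b ∈ C (E \ σ) ∧ b ∉ C σ) ∧
      (ha (C σ) = 1 ∧ ka (C σ) = 1 ∧ hb (C (E \ σ)) = 0 ∧ kb (C (E \ σ)) = 0)) with hP
  set LL : Finset (Finset ι) := (E.powerset).filter (fun lam => 𝒱 lam ∧ (b ∈ C lam ∧ b ∉ C (E \ lam)) ∧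
      ((ha (C lam) = 1 ∧ kb (C lam) = 1 ∧ hb (C (E \ lam)) = 0 ∧ ka (C (E \ lam)) = 0) ∨
        (ka (C lam) = 1 ∧ hb (C lam) = 1 ∧ kb (C (E \ lam)) = 0 ∧ ha (C (E \ lam)) = 0))) with hLL
  have hLLT : LL ⊆ T := by
    intro lam hlam
    rw [hLL, Finset.mem_filter] at hlam
    rw [hT, Finset.mem_filter]
    refine ⟨hlam.1, hlam.2.1, hlam.2.2.1, ?_⟩
    rcases hlam.2.2.2 with hl | hl
    · exact ⟨up1 ha h h01' hah _ hl.1, up1 kb k k01 kbk _ hl.2.1⟩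
    · exact ⟨up1 hb h h01' hbh _ hl.2.1, up1 ka k k01 kak _ hl.1⟩
  have cLLT := Finset.card_le_card hLLT
  -- ## a source has a blue thread
  have blue_thread : ∀ σ : Finset ι, σ ⊆ E → b ∈ C (E \ σ) → ∃ t, t < r ∧ Disjoint (A t) σ := by
    intro σ _ hbY
    obtain ⟨t, ht, hsub⟩ := (full_iff (E \ σ) Finset.sdiff_subset).mp hbY
    exact ⟨t, ht, Finset.disjoint_left.mpr fun x hx hxσ => (Finset.mem_sdiff.mp (hsub hx)).2 hxσ⟩
  have notstart : ∀ (σ : Finset ι) (t : ℕ), t < r → Disjoint (A t) σ → e t 1 ∉ σ :=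
    fun σ t ht hd hm => Finset.disjoint_left.mp hd (heA t ht 1 (le_refl 1) (hL t ht)) hm
  -- ## empty types: Harris for the other type (merged scheme, nothing frozen)
  by_cases hne₁ : ∃ σ, σ ∈ B₁
  swap
  · have e0 : B₁ = ∅ := Finset.eq_empty_of_forall_notMem fun σ hσ => hne₁ ⟨σ, hσ⟩
    have m₂ := bundle_merged_scheme_count ends r L hL w e u b hw0 hwL harc hwinj hcross A hA hAdisj E hEA t₀ t₁ ht₀ ht₁ h01 𝒱 hV
      ka kb ha hb mka mkb mha mhb ka01 kb01 ha01 hb01 {0} {0} (Or.inl rfl) (Or.inl rfl)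
      (fun h' => absurd h' (hIcc t₀ ht₀)) (fun h' => absurd h' (hIcc t₁ ht₁))
    have sub : (E.powerset).filter (fun lam => 𝒱 lam ∧ (b ∈ C lam ∧ b ∉ C (E \ lam)) ∧
        (ka (C lam) = 1 ∧ hb (C lam) = 1 ∧ kb (C (E \ lam)) = 0 ∧ ha (C (E \ lam)) = 0) ∧
        (({0} : Finset ℕ) = Finset.Icc 1 (L t₀ - 1) → e t₀ 1 ∈ lam ∧ ¬ A t₀ ⊆ lam) ∧
        (({0} : Finset ℕ) = Finset.Icc 1 (L t₁ - 1) → e t₁ 1 ∈ lam ∧ ¬ A t₁ ⊆ lam)) ⊆ T := by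
      intro lam hlam
      rw [Finset.mem_filter] at hlam
      rw [hT, Finset.mem_filter]
      exact ⟨hlam.1, hlam.2.1, hlam.2.2.1, up1 hb h h01' hbh _ hlam.2.2.2.1.2.1, up1 ka k k01 kak _ hlam.2.2.2.1.1⟩
    have c := Finset.card_le_card sub
    have m₂' : B₂.card ≤ ((E.powerset).filter (fun lam => 𝒱 lam ∧ (b ∈ C lam ∧ b ∉ C (E \ lam)) ∧
        (ka (C lam) = 1 ∧ hb (C lam) = 1 ∧ kb (C (E \ lam)) = 0 ∧ ha (C (E \ lam)) = 0) ∧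
        (({0} : Finset ℕ) = Finset.Icc 1 (L t₀ - 1) → e t₀ 1 ∈ lam ∧ ¬ A t₀ ⊆ lam) ∧
        (({0} : Finset ℕ) = Finset.Icc 1 (L t₁ - 1) → e t₁ 1 ∈ lam ∧ ¬ A t₁ ⊆ lam))).card := by
      convert m₂ using 3
    rw [e0, Finset.card_empty]
    omega
  by_cases hne₂ : ∃ σ, σ ∈ B₂
  swap
  · have e0 : B₂ = ∅ := Finset.eq_empty_of_forall_notMem fun σ hσ => hne₂ ⟨σ, hσ⟩
    have m₁ := bundle_merged_scheme_count ends r L hL w e u b hw0 hwL harc hwinj hcross A hA hAdisj E hEA t₀ t₁ ht₀ ht₁ h01 𝒱 hV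
      ha hb ka kb mha mhb mka mkb ha01 hb01 ka01 kb01 {0} {0} (Or.inl rfl) (Or.inl rfl)
      (fun h' => absurd h' (hIcc t₀ ht₀)) (fun h' => absurd h' (hIcc t₁ ht₁))
    have sub : (E.powerset).filter (fun lam => 𝒱 lam ∧ (b ∈ C lam ∧ b ∉ C (E \ lam)) ∧
        (ha (C lam) = 1 ∧ kb (C lam) = 1 ∧ hb (C (E \ lam)) = 0 ∧ ka (C (E \ lam)) = 0) ∧
        (({0} : Finset ℕ) = Finset.Icc 1 (L t₀ - 1) → e t₀ 1 ∈ lam ∧ ¬ A t₀ ⊆ lam) ∧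
        (({0} : Finset ℕ) = Finset.Icc 1 (L t₁ - 1) → e t₁ 1 ∈ lam ∧ ¬ A t₁ ⊆ lam)) ⊆ T := by
      intro lam hlam
      rw [Finset.mem_filter] at hlam
      rw [hT, Finset.mem_filter]
      exact ⟨hlam.1, hlam.2.1, hlam.2.2.1, up1 ha h h01' hah _ hlam.2.2.2.1.1, up1 kb k k01 kbk _ hlam.2.2.2.1.2.1⟩
    have c := Finset.card_le_card sub
    have m₁' : B₁.card ≤ ((E.powerset).filter (fun lam => 𝒱 lam ∧ (b ∈ C lam ∧ b ∉ C (E \ lam)) ∧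
        (ha (C lam) = 1 ∧ kb (C lam) = 1 ∧ hb (C (E \ lam)) = 0 ∧ ka (C (E \ lam)) = 0) ∧
        (({0} : Finset ℕ) = Finset.Icc 1 (L t₀ - 1) → e t₀ 1 ∈ lam ∧ ¬ A t₀ ⊆ lam) ∧
        (({0} : Finset ℕ) = Finset.Icc 1 (L t₁ - 1) → e t₁ 1 ∈ lam ∧ ¬ A t₁ ⊆ lam))).card := by
      convert m₁ using 3
    rw [e0, Finset.card_empty]
    omega
  -- ## case 1: some thread on which both types have a non-red-starting source — CT-COUNT + fills
  have caseZ : ∀ z p q : ℕ, z < r → p < r → q < r → z ≠ p → z ≠ q → p ≠ q → (∀ t, t < r → t = z ∨ t = p ∨ t = q) →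
      (∃ σ, σ ∈ B₁ ∧ e z 1 ∉ σ) → (∃ σ, σ ∈ B₂ ∧ e z 1 ∉ σ) → B₁.card + B₂.card ≤ T.card + P.card := by
    intro z p q hz hp hq hzp hzq hpq hr3' hA1 hA2
    have hz1 : e z 1 ∈ A z := heA z hz 1 (le_refl 1) (hL z hz)
    have ct := bundle_clean_thread_count ends r L hL w e u b hw0 hwL harc hwinj hcross A hA hAdisj E hEA z p q hz hp hq hzp hzq hpq hr3' 𝒱 hV
      ha hb ka kb mha mhb mka mkb ha01 hb01 ka01 kb01
    obtain ⟨σ₁, hσ₁, hz₁⟩ := hA1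
    obtain ⟨σ₂, hσ₂, hz₂⟩ := hA2
    rw [hB₁, Finset.mem_filter, Finset.mem_powerset] at hσ₁
    rw [hB₂, Finset.mem_filter, Finset.mem_powerset] at hσ₂
    have fl := bundle_fill_count ends r L hL w e u b hw0 hwL harc hwinj hcross A hA hAdisj E hEA z p q hz hp hq hzp hzq hpq hr3' 𝒱 hV
      h k ha hb ka kb mha mka h01' k01 ha01 ka01 hah kak ⟨σ₁, hσ₁.1, hz₁, hσ₁.2⟩ ⟨σ₂, hσ₂.1, hz₂, hσ₂.2⟩
    -- splitting the sources by 'blue-starting on z'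
    have s₁ : B₁.card = ((E.powerset).filter (fun σ => (e z 1 ∈ σ ∨ Disjoint (A z) σ) ∧ 𝒱 σ ∧ (b ∈ C (E \ σ) ∧ b ∉ C σ) ∧
        (ha (C σ) = 1 ∧ hb (C (E \ σ)) = 0) ∧ (kb (C (E \ σ)) = 1 ∧ ka (C σ) = 0))).card +
        ((E.powerset).filter (fun σ => (e z 1 ∉ σ ∧ ¬ Disjoint (A z) σ) ∧ 𝒱 σ ∧ (b ∈ C (E \ σ) ∧ b ∉ C σ) ∧
        (ha (C σ) = 1 ∧ hb (C (E \ σ)) = 0) ∧ (kb (C (E \ σ)) = 1 ∧ ka (C σ) = 0))).card := by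
      rw [hB₁, ← Finset.card_union_of_disjoint]
      · congr 1
        ext σ
        simp only [Finset.mem_filter, Finset.mem_union]
        constructor
        · intro hh
          by_cases hc : e z 1 ∈ σ ∨ Disjoint (A z) σ
          · exact Or.inl ⟨hh.1, hc, hh.2⟩
          · exact Or.inr ⟨hh.1, ⟨fun h1 => hc (Or.inl h1), fun h2 => hc (Or.inr h2)⟩, hh.2⟩
        · rintro (⟨hE', -, hrest⟩ | ⟨hE', -, hrest⟩) <;> exact ⟨hE', hrest⟩
      · rw [Finset.disjoint_filter]
        intro σ _ h1 h2
        exact h1.1.elim h2.1.1 h2.1.2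
    have s₂ : B₂.card = ((E.powerset).filter (fun σ => (e z 1 ∈ σ ∨ Disjoint (A z) σ) ∧ 𝒱 σ ∧ (b ∈ C (E \ σ) ∧ b ∉ C σ) ∧
        (ka (C σ) = 1 ∧ kb (C (E \ σ)) = 0) ∧ (hb (C (E \ σ)) = 1 ∧ ha (C σ) = 0))).card +
        ((E.powerset).filter (fun σ => (e z 1 ∉ σ ∧ ¬ Disjoint (A z) σ) ∧ 𝒱 σ ∧ (b ∈ C (E \ σ) ∧ b ∉ C σ) ∧
        (ka (C σ) = 1 ∧ kb (C (E \ σ)) = 0) ∧ (hb (C (E \ σ)) = 1 ∧ ha (C σ) = 0))).card := by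
      rw [hB₂, ← Finset.card_union_of_disjoint]
      · congr 1
        ext σ
        simp only [Finset.mem_filter, Finset.mem_union]
        constructor
        · intro hh
          by_cases hc : e z 1 ∈ σ ∨ Disjoint (A z) σ
          · exact Or.inl ⟨hh.1, hc, hh.2⟩
          · exact Or.inr ⟨hh.1, ⟨fun h1 => hc (Or.inl h1), fun h2 => hc (Or.inr h2)⟩, hh.2⟩
        · rintro (⟨hE', -, hrest⟩ | ⟨hE', -, hrest⟩) <;> exact ⟨hE', hrest⟩
      · rw [Finset.disjoint_filter]
        intro σ _ h1 h2
        exact h1.1.elim h2.1.1 h2.1.2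
    -- the targets: red-starting L-points and blue-starting h·k-points are disjoint parts of T; P₁ with z blue ⊆ P
    have tg : ((E.powerset).filter (fun lam => e z 1 ∈ lam ∧ 𝒱 lam ∧ (b ∈ C lam ∧ b ∉ C (E \ lam)) ∧
        ((ha (C lam) = 1 ∧ kb (C lam) = 1 ∧ hb (C (E \ lam)) = 0 ∧ ka (C (E \ lam)) = 0) ∨
          (ka (C lam) = 1 ∧ hb (C lam) = 1 ∧ kb (C (E \ lam)) = 0 ∧ ha (C (E \ lam)) = 0)))).card +
        ((E.powerset).filter (fun lam => (e z 1 ∉ lam ∧ ¬ Disjoint (A z) lam) ∧ 𝒱 lam ∧ (b ∈ C lam ∧ b ∉ C (E \ lam)) ∧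
        h (C lam) = 1 ∧ k (C lam) = 1)).card ≤ T.card := by
      rw [← Finset.card_union_of_disjoint]
      · apply Finset.card_le_card
        intro lam hlam
        rw [Finset.mem_union, Finset.mem_filter, Finset.mem_filter] at hlam
        rw [hT, Finset.mem_filter]
        rcases hlam with hl | hl
        · refine ⟨hl.1, hl.2.2.1, hl.2.2.2.1, ?_⟩
          rcases hl.2.2.2.2 with h' | h'
          · exact ⟨up1 ha h h01' hah _ h'.1, up1 kb k k01 kbk _ h'.2.1⟩
          · exact ⟨up1 hb h h01' hbh _ h'.2.1, up1 ka k k01 kak _ h'.1⟩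
        · exact ⟨hl.1, hl.2.2.1, hl.2.2.2.1, hl.2.2.2.2⟩
      · rw [Finset.disjoint_filter]
        intro lam _ h1 h2
        exact h2.1.1 h1.1
    have pg : ((E.powerset).filter (fun σ => Disjoint (A z) σ ∧ 𝒱 σ ∧ (b ∈ C (E \ σ) ∧ b ∉ C σ) ∧
        (ha (C σ) = 1 ∧ ka (C σ) = 1 ∧ hb (C (E \ σ)) = 0 ∧ kb (C (E \ σ)) = 0))).card ≤ P.card := by
      apply Finset.card_le_card
      intro σ hσ
      rw [Finset.mem_filter] at hσ
      rw [hP, Finset.mem_filter]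
      exact ⟨hσ.1, hσ.2.2⟩
    have ct' : ((E.powerset).filter (fun σ => (e z 1 ∈ σ ∨ Disjoint (A z) σ) ∧ 𝒱 σ ∧ (b ∈ C (E \ σ) ∧ b ∉ C σ) ∧
        (ha (C σ) = 1 ∧ hb (C (E \ σ)) = 0) ∧ (kb (C (E \ σ)) = 1 ∧ ka (C σ) = 0))).card +
        ((E.powerset).filter (fun σ => (e z 1 ∈ σ ∨ Disjoint (A z) σ) ∧ 𝒱 σ ∧ (b ∈ C (E \ σ) ∧ b ∉ C σ) ∧
        (ka (C σ) = 1 ∧ kb (C (E \ σ)) = 0) ∧ (hb (C (E \ σ)) = 1 ∧ ha (C σ) = 0))).card ≤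
        ((E.powerset).filter (fun lam => e z 1 ∈ lam ∧ 𝒱 lam ∧ (b ∈ C lam ∧ b ∉ C (E \ lam)) ∧
        ((ha (C lam) = 1 ∧ kb (C lam) = 1 ∧ hb (C (E \ lam)) = 0 ∧ ka (C (E \ lam)) = 0) ∨
          (ka (C lam) = 1 ∧ hb (C lam) = 1 ∧ kb (C (E \ lam)) = 0 ∧ ha (C (E \ lam)) = 0)))).card +
        ((E.powerset).filter (fun σ => Disjoint (A z) σ ∧ 𝒱 σ ∧ (b ∈ C (E \ σ) ∧ b ∉ C σ) ∧
        (ha (C σ) = 1 ∧ ka (C σ) = 1 ∧ hb (C (E \ σ)) = 0 ∧ kb (C (E \ σ)) = 0))).card := by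
      convert ct using 3
    have fl' : ((E.powerset).filter (fun σ => (e z 1 ∉ σ ∧ ¬ Disjoint (A z) σ) ∧ 𝒱 σ ∧ (b ∈ C (E \ σ) ∧ b ∉ C σ) ∧
        (ha (C σ) = 1 ∧ hb (C (E \ σ)) = 0) ∧ (kb (C (E \ σ)) = 1 ∧ ka (C σ) = 0))).card +
        ((E.powerset).filter (fun σ => (e z 1 ∉ σ ∧ ¬ Disjoint (A z) σ) ∧ 𝒱 σ ∧ (b ∈ C (E \ σ) ∧ b ∉ C σ) ∧
        (ka (C σ) = 1 ∧ kb (C (E \ σ)) = 0) ∧ (hb (C (E \ σ)) = 1 ∧ ha (C σ) = 0))).card ≤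
        ((E.powerset).filter (fun lam => (e z 1 ∉ lam ∧ ¬ Disjoint (A z) lam) ∧ 𝒱 lam ∧ (b ∈ C lam ∧ b ∉ C (E \ lam)) ∧
        h (C lam) = 1 ∧ k (C lam) = 1)).card := by
      convert fl using 3
    omega
  by_cases hex : ∃ z, (z = t₀ ∨ z = t₁ ∨ z = t₂) ∧ (∃ σ, σ ∈ B₁ ∧ e z 1 ∉ σ) ∧ (∃ σ, σ ∈ B₂ ∧ e z 1 ∉ σ)
  · obtain ⟨z, hz3, hA1, hA2⟩ := hex
    have goal : B₁.card + B₂.card ≤ T.card + P.card := by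
      rcases hz3 with rfl | rfl | rfl
      · exact caseZ _ t₁ t₂ ht₀ ht₁ ht₂ h01 h02 h12 hr3 hA1 hA2
      · exact caseZ _ t₀ t₂ ht₁ ht₀ ht₂ h01.symm h12 h02
          (fun t ht => (hr3 t ht).elim (fun h' => Or.inr (Or.inl h')) fun h' => h'.elim Or.inl fun h' => Or.inr (Or.inr h')) hA1 hA2
      · exact caseZ _ t₀ t₁ ht₂ ht₀ ht₁ h02.symm h12.symm h01
          (fun t ht => (hr3 t ht).elim (fun h' => Or.inr (Or.inl h')) fun h' => h'.elim (fun h' => Or.inr (Or.inr h')) Or.inl) hA1 hA2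
    exact goal
  -- ## case 2: every thread is red-starting for all sources of one type — TWO-FREEZE
  push Not at hex
  have R : ∀ t, (t = t₀ ∨ t = t₁ ∨ t = t₂) → (∀ σ, σ ∈ B₁ → e t 1 ∈ σ) ∨ (∀ σ, σ ∈ B₂ → e t 1 ∈ σ) := by
    intro t ht
    by_contra hno
    rw [not_or] at hno
    push Not at hno
    obtain ⟨⟨σ₁, h₁, hn₁⟩, ⟨σ₂, h₂, hn₂⟩⟩ := hno
    exact hn₂ (hex t ht ⟨σ₁, h₁, hn₁⟩ σ₂ h₂)
  -- a type with a source is not red-starting everywhere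
  have notall₁ : ¬ ((∀ σ, σ ∈ B₁ → e t₀ 1 ∈ σ) ∧ (∀ σ, σ ∈ B₁ → e t₁ 1 ∈ σ) ∧ (∀ σ, σ ∈ B₁ → e t₂ 1 ∈ σ)) := by
    rintro ⟨r0, r1, r2⟩
    obtain ⟨σ, hσ⟩ := hne₁
    have hσ' := hσ; rw [hB₁, Finset.mem_filter, Finset.mem_powerset] at hσ'
    obtain ⟨t, ht, hd⟩ := blue_thread σ hσ'.1 hσ'.2.2.1.1
    rcases hr3 t ht with rfl | rfl | rfl
    · exact notstart σ _ ht hd (r0 σ hσ)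
    · exact notstart σ _ ht hd (r1 σ hσ)
    · exact notstart σ _ ht hd (r2 σ hσ)
  have notall₂ : ¬ ((∀ σ, σ ∈ B₂ → e t₀ 1 ∈ σ) ∧ (∀ σ, σ ∈ B₂ → e t₁ 1 ∈ σ) ∧ (∀ σ, σ ∈ B₂ → e t₂ 1 ∈ σ)) := by
    rintro ⟨r0, r1, r2⟩
    obtain ⟨σ, hσ⟩ := hne₂
    have hσ' := hσ; rw [hB₂, Finset.mem_filter, Finset.mem_powerset] at hσ'
    obtain ⟨t, ht, hd⟩ := blue_thread σ hσ'.1 hσ'.2.2.1.1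
    rcases hr3 t ht with rfl | rfl | rfl
    · exact notstart σ _ ht hd (r0 σ hσ)
    · exact notstart σ _ ht hd (r1 σ hσ)
    · exact notstart σ _ ht hd (r2 σ hσ)
  -- two-freeze with type 1 freezing `a` (and `c` if it can), type 2 freezing `d` (and `c` otherwise)
  have TF : ∀ a c d : ℕ, a < r → c < r → d < r → a ≠ c → a ≠ d → c ≠ d → (∀ t, t < r → t = a ∨ t = c ∨ t = d) →
      (∀ σ, σ ∈ B₁ → e a 1 ∈ σ) → (∀ σ, σ ∈ B₂ → e d 1 ∈ σ) → ((∀ σ, σ ∈ B₁ → e c 1 ∈ σ) ∨ (∀ σ, σ ∈ B₂ → e c 1 ∈ σ)) →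
      B₁.card + B₂.card ≤ T.card + P.card := by
    intro a c d ha' hc hd hac had hcd hr3' Ra Rd Rc
    have cov₁ : ∀ σ, σ ⊆ E → (𝒱 σ ∧ (b ∈ C (E \ σ) ∧ b ∉ C σ) ∧ (ha (C σ) = 1 ∧ hb (C (E \ σ)) = 0) ∧ (kb (C (E \ σ)) = 1 ∧ ka (C σ) = 0)) →
        σ ∈ B₁ := fun σ hσ hs => by rw [hB₁, Finset.mem_filter, Finset.mem_powerset]; exact ⟨hσ, hs⟩
    have cov₂ : ∀ σ, σ ⊆ E → (𝒱 σ ∧ (b ∈ C (E \ σ) ∧ b ∉ C σ) ∧ (ka (C σ) = 1 ∧ kb (C (E \ σ)) = 0) ∧ (hb (C (E \ σ)) = 1 ∧ ha (C σ) = 0)) →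
        σ ∈ B₂ := fun σ hσ hs => by rw [hB₂, Finset.mem_filter, Finset.mem_powerset]; exact ⟨hσ, hs⟩
    rcases Rc with Rc | Rc
    · have tf := bundle_two_freeze_count ends r L hL w e u b hw0 hwL harc hwinj hcross A hA hAdisj E hEA a c ha' hc hac d c hd hc hcd.symm 𝒱 hV
        ha hb ka kb mha mhb mka mkb ha01 hb01 ka01 kb01 (Finset.Icc 1 (L a - 1)) (Finset.Icc 1 (L c - 1)) (Finset.Icc 1 (L d - 1)) {0}
        (Or.inr rfl) (Or.inr rfl) (Or.inr rfl) (Or.inl rfl)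
        (fun _ σ hσ hs => Ra σ (cov₁ σ hσ hs)) (fun _ σ hσ hs => Rc σ (cov₁ σ hσ hs)) (fun _ σ hσ hs => Rd σ (cov₂ σ hσ hs))
        (fun h' => absurd h' (hIcc c hc))
        (fun t ht => (hr3' t ht).elim (fun h' => Or.inl ⟨h', rfl⟩) fun h' => h'.elim (fun h' => Or.inr (Or.inl ⟨h', rfl⟩))
          fun h' => Or.inr (Or.inr (Or.inl ⟨h', rfl⟩)))
      have tf' : B₁.card + B₂.card ≤ LL.card := by convert tf using 3
      omega
    · have tf := bundle_two_freeze_count ends r L hL w e u b hw0 hwL harc hwinj hcross A hA hAdisj E hEA a c ha' hc hac d c hd hc hcd.symm 𝒱 hV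
        ha hb ka kb mha mhb mka mkb ha01 hb01 ka01 kb01 (Finset.Icc 1 (L a - 1)) {0} (Finset.Icc 1 (L d - 1)) (Finset.Icc 1 (L c - 1))
        (Or.inr rfl) (Or.inl rfl) (Or.inr rfl) (Or.inr rfl)
        (fun _ σ hσ hs => Ra σ (cov₁ σ hσ hs)) (fun h' => absurd h' (hIcc c hc)) (fun _ σ hσ hs => Rd σ (cov₂ σ hσ hs))
        (fun _ σ hσ hs => Rc σ (cov₂ σ hσ hs))
        (fun t ht => (hr3' t ht).elim (fun h' => Or.inl ⟨h', rfl⟩) fun h' => h'.elim (fun h' => Or.inr (Or.inr (Or.inr ⟨h', rfl⟩)))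
          fun h' => Or.inr (Or.inr (Or.inl ⟨h', rfl⟩)))
      have tf' : B₁.card + B₂.card ≤ LL.card := by convert tf using 3
      omega
  have p012 : ∀ t, t < r → t = t₀ ∨ t = t₁ ∨ t = t₂ := hr3
  have p021 : ∀ t, t < r → t = t₀ ∨ t = t₂ ∨ t = t₁ := fun t ht => (hr3 t ht).elim Or.inl fun h' => h'.elim (fun h' => Or.inr (Or.inr h')) fun h' => Or.inr (Or.inl h')
  have p102 : ∀ t, t < r → t = t₁ ∨ t = t₀ ∨ t = t₂ := fun t ht => (hr3 t ht).elim (fun h' => Or.inr (Or.inl h')) fun h' => h'.elim Or.inl fun h' => Or.inr (Or.inr h')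
  have p120 : ∀ t, t < r → t = t₁ ∨ t = t₂ ∨ t = t₀ := fun t ht => (hr3 t ht).elim (fun h' => Or.inr (Or.inr h')) fun h' => h'.elim Or.inl fun h' => Or.inr (Or.inl h')
  have p201 : ∀ t, t < r → t = t₂ ∨ t = t₀ ∨ t = t₁ := fun t ht => (hr3 t ht).elim (fun h' => Or.inr (Or.inl h')) fun h' => h'.elim (fun h' => Or.inr (Or.inr h')) Or.inl
  have p210 : ∀ t, t < r → t = t₂ ∨ t = t₁ ∨ t = t₀ := fun t ht => (hr3 t ht).elim (fun h' => Or.inr (Or.inr h')) fun h' => h'.elim (fun h' => Or.inr (Or.inl h')) Or.inl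
  rcases R t₀ (Or.inl rfl) with a0 | b0 <;> rcases R t₁ (Or.inr (Or.inl rfl)) with a1 | b1 <;> rcases R t₂ (Or.inr (Or.inr rfl)) with a2 | b2
  · exact absurd ⟨a0, a1, a2⟩ notall₁
  · exact TF t₀ t₁ t₂ ht₀ ht₁ ht₂ h01 h02 h12 p012 a0 b2 (Or.inl a1)
  · exact TF t₀ t₂ t₁ ht₀ ht₂ ht₁ h02 h01 h12.symm p021 a0 b1 (Or.inl a2)
  · exact TF t₀ t₂ t₁ ht₀ ht₂ ht₁ h02 h01 h12.symm p021 a0 b1 (Or.inr b2)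
  · exact TF t₁ t₂ t₀ ht₁ ht₂ ht₀ h12 h01.symm h02.symm p120 a1 b0 (Or.inl a2)
  · exact TF t₁ t₂ t₀ ht₁ ht₂ ht₀ h12 h01.symm h02.symm p120 a1 b0 (Or.inr b2)
  · exact TF t₂ t₁ t₀ ht₂ ht₁ ht₀ h12.symm h02.symm h01.symm p210 a2 b0 (Or.inr b1)
  · exact absurd ⟨b0, b1, b2⟩ notall₂

end Coefficientwise

end Summit.CriticalPhenomena.PercolationContinuityZ3.Theorems
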